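import Mathlib
import Summits.ResolutionOfSingularities.ResolutionOfSingularities.Theorems.WeightedInvariantLocalWeightedDropMonicDescentGraphCurveTools

/-!
# `WeightedInvariant.LocalWeightedDrop`, sub-stub N4″: two WELL-PREPARED labels differing by a re-centring have the same `(α, β)` and `(ζ, ε)` (tool for T-5′)

Crux item stmt-ResolutionOfSingularities-8899 `LocalWeightedDrop` (route `ResolutionOfSingularities/WeightedInvariant`), door
`WeightedConstruction` stmt-ResolutionOfSingularities-0571.  [OURS · L1 W4.3, chain w43, lead prover; tool for the tail argument (t3) of piece T-5′ of
`N4PRIME-PLAN.md`.  MODEL: Hironaka's theorem `Δ(f; y; u) = Δ(f; u)` for well-prepared `y` (Cossart–Jannsen–Saito LNM 2270 Thm 8.16) — here only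
its consequence for the four integer invariants of pairs over `k̄[[u₁,u₂]]` in characteristic 2, from `exists_low_exponent_of_recentre` (p486315).]

* `alphaL_le_of_wellPrepared_recentre`, `lexLe_of_wellPrepared_recentre` — if `X` is well prepared then ANY re-centring `Y` of `X` has
  `(2α, 2β)(Y) ≤_lex (2α, 2β)(X)`; `rowLe_of_wellPrepared_recentre` — likewise `(2ε, 2ζ)(Y) ≤_lex (2ε, 2ζ)(X)`;
* `alphaL_betaL_eq_of_wellPrepared`, `epsL_zetaL_eq_of_wellPrepared` — if BOTH are well prepared (re-centring is an involution in char 2) the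
  invariants coincide.
-/

set_option linter.dupNamespace false -- mandated namespace of this single-conjunct summit

noncomputable section

namespace Summit.ResolutionOfSingularities.ResolutionOfSingularities.Theorems

namespace MonicDescent

open MvPowerSeries

variable {k : Type} [Field k] [CharP k 2]

/-- LEX COMPARISON: if `X = (A₀, A₁)` is well prepared with non-empty Newton set, every re-centring `Y` has a Newton point lexicographically
`≤ (2α(X), 2β(X))`: precisely `2α(Y) < 2α(X)`, or `2α(Y) = 2α(X)` and `2β(Y) ≤ 2β(X)`. -/
theorem lexLe_of_wellPrepared_recentre {A₀ A₁ : MvPowerSeries (Fin 2) k} (hWP : WellPrepared A₀ A₁) (hne : (newtonSet A₀ A₁).Nonempty)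
    (ψ : MvPowerSeries (Fin 2) k) :
    alphaL (newtonSet (A₀ + A₁ * ψ + ψ ^ 2) A₁) < alphaL (newtonSet A₀ A₁) ∨
    (alphaL (newtonSet (A₀ + A₁ * ψ + ψ ^ 2) A₁) = alphaL (newtonSet A₀ A₁) ∧
      betaL (newtonSet (A₀ + A₁ * ψ + ψ ^ 2) A₁) ≤ betaL (newtonSet A₀ A₁)) := by
  set N := newtonSet A₀ A₁ with hN
  set N' := newtonSet (A₀ + A₁ * ψ + ψ ^ 2) A₁ with hN'
  obtain ⟨P, hP, hP0, hP1⟩ := exists_eq_betaL hne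
  have hPodd : IsOdd A₀ A₁ P := hWP P (isVertex_lexMin hP hP0 hP1)
  -- a point `Q ∈ N'` with `Q ≤_lex P`
  have hQ : ∃ Q ∈ N', Q 0 < P 0 ∨ (Q 0 = P 0 ∧ Q 1 ≤ P 1) := by
    rcases hPodd with ⟨e, rfl, he⟩ | ⟨hc, hi⟩
    · exact ⟨2 • e, Or.inr ⟨e, rfl, he⟩, Or.inr ⟨rfl, le_rfl⟩⟩
    · by_cases hA1pt : ∃ e : Fin 2 →₀ ℕ, P = 2 • e ∧ coeff e A₁ ≠ 0
      · obtain ⟨e, hPe, he⟩ := hA1pt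
        exact ⟨P, Or.inr ⟨e, hPe, he⟩, Or.inr ⟨rfl, le_rfl⟩⟩
      push Not at hA1pt
      set L : ℕ := P 1 + 1 with hL
      set w : Fin 2 → ℕ := fun i => if i = 0 then L else 1 with hw
      have hweight : ∀ d : Fin 2 →₀ ℕ, Finsupp.weight w d = L * d 0 + d 1 := by
        intro d
        rw [Finsupp.weight_apply, Finsupp.sum_fintype _ _ (by simp)]
        simp [Fin.sum_univ_two, hw]
        ring
      obtain ⟨d, hd, hdle⟩ := exists_low_exponent_of_recentre w A₀ A₁ ψ P hc hi
        (fun d hd => by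
          rw [hweight, hweight]
          have hd0 := alphaL_le (N := N) (Or.inl hd)
          rcases Nat.lt_or_ge (P 0) (d 0) with hlt | hge
          · nlinarith
          · have hd0eq : d 0 = alphaL N := by omega
            have := betaL_le (N := N) (Or.inl hd) hd0eq
            rw [hP0, hP1, hd0eq]; omega)
        (fun a ha => by
          rw [hweight, hweight]
          have hmem : (2 • a) ∈ N := Or.inr ⟨a, rfl, ha⟩
          have ha0 := alphaL_le hmem
          simp only [Finsupp.smul_apply, smul_eq_mul] at ha0
          rcases Nat.lt_or_ge (P 0) (2 * a 0) with hlt | hge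
          · nlinarith
          · have ha0eq : (2 • a) 0 = alphaL N := by simp only [Finsupp.smul_apply, smul_eq_mul]; omega
            have ha1 := betaL_le hmem ha0eq
            simp only [Finsupp.smul_apply, smul_eq_mul] at ha1
            have hne2 : 2 • a ≠ P := fun h => ha (hA1pt a h.symm)
            have hne1 : 2 * a 1 ≠ P 1 := by
              intro h
              apply hne2
              exact Literature.RingTheory.TwoVariableSeries.finsupp_fin2_ext
                (by simp only [Finsupp.smul_apply, smul_eq_mul]; omega) (by simp only [Finsupp.smul_apply, smul_eq_mul]; omega)
            have h2a0 : 2 * a 0 = P 0 := by omega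
            have hP1le : P 1 ≤ 2 * a 1 := by rw [hP1]; exact ha1
            have hexp : 2 * (L * a 0 + a 1) = L * (2 * a 0) + 2 * a 1 := by ring
            rw [hexp, h2a0]
            omega)
      refine ⟨d, Or.inl hd, ?_⟩
      rw [hweight, hweight] at hdle
      rcases Nat.lt_or_ge (d 0) (P 0) with hlt | hge
      · exact Or.inl hlt
      · right
        have : d 0 = P 0 := by
          by_contra hne
          have hgt : P 0 < d 0 := by omega
          nlinarith
        refine ⟨this, ?_⟩
        rw [this] at hdle
        omega
  obtain ⟨Q, hQN', hQle⟩ := hQ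
  have hαQ := alphaL_le hQN'
  rcases hQle with hlt | ⟨h0, h1⟩
  · left; rw [← hP0]; omega
  · rcases Nat.lt_or_ge (alphaL N') (alphaL N) with hlt' | hge'
    · exact Or.inl hlt'
    · right
      have hαeq : alphaL N' = alphaL N := by rw [← hP0, ← h0]; omega
      refine ⟨hαeq, ?_⟩
      rw [← hP1]
      exact le_trans (betaL_le hQN' (by rw [hαeq, h0, hP0])) h1

/-- ROW COMPARISON (mirror): every re-centring `Y` of a well-prepared `X` has `2ε(Y) < 2ε(X)`, or `2ε(Y) = 2ε(X)` and `2ζ(Y) ≤ 2ζ(X)`. -/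
theorem rowLe_of_wellPrepared_recentre {A₀ A₁ : MvPowerSeries (Fin 2) k} (hWP : WellPrepared A₀ A₁) (hne : (newtonSet A₀ A₁).Nonempty)
    (ψ : MvPowerSeries (Fin 2) k) :
    epsL (newtonSet (A₀ + A₁ * ψ + ψ ^ 2) A₁) < epsL (newtonSet A₀ A₁) ∨
    (epsL (newtonSet (A₀ + A₁ * ψ + ψ ^ 2) A₁) = epsL (newtonSet A₀ A₁) ∧
      zetaL (newtonSet (A₀ + A₁ * ψ + ψ ^ 2) A₁) ≤ zetaL (newtonSet A₀ A₁)) := by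
  set N := newtonSet A₀ A₁ with hN
  set N' := newtonSet (A₀ + A₁ * ψ + ψ ^ 2) A₁ with hN'
  obtain ⟨P, hP, hP1, hP0⟩ := exists_eq_zetaL hne
  have hPodd : IsOdd A₀ A₁ P := hWP P (isVertex_rowMin hP hP1 hP0)
  have hQ : ∃ Q ∈ N', Q 1 < P 1 ∨ (Q 1 = P 1 ∧ Q 0 ≤ P 0) := by
    rcases hPodd with ⟨e, rfl, he⟩ | ⟨hc, hi⟩
    · exact ⟨2 • e, Or.inr ⟨e, rfl, he⟩, Or.inr ⟨rfl, le_rfl⟩⟩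
    · by_cases hA1pt : ∃ e : Fin 2 →₀ ℕ, P = 2 • e ∧ coeff e A₁ ≠ 0
      · obtain ⟨e, hPe, he⟩ := hA1pt
        exact ⟨P, Or.inr ⟨e, hPe, he⟩, Or.inr ⟨rfl, le_rfl⟩⟩
      push Not at hA1pt
      set L : ℕ := P 0 + 1 with hL
      set w : Fin 2 → ℕ := fun i => if i = 0 then 1 else L with hw
      have hweight : ∀ d : Fin 2 →₀ ℕ, Finsupp.weight w d = d 0 + L * d 1 := by
        intro d
        rw [Finsupp.weight_apply, Finsupp.sum_fintype _ _ (by simp)]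
        simp [Fin.sum_univ_two, hw]
        ring
      obtain ⟨d, hd, hdle⟩ := exists_low_exponent_of_recentre w A₀ A₁ ψ P hc hi
        (fun d hd => by
          rw [hweight, hweight]
          have hd1 := epsL_le (N := N) (Or.inl hd)
          rcases Nat.lt_or_ge (P 1) (d 1) with hlt | hge
          · nlinarith
          · have hd1eq : d 1 = epsL N := by omega
            have := zetaL_le (N := N) (Or.inl hd) hd1eq
            rw [hP0, hP1, hd1eq]; omega)
        (fun a ha => by
          rw [hweight, hweight]
          have hmem : (2 • a) ∈ N := Or.inr ⟨a, rfl, ha⟩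
          have ha1 := epsL_le hmem
          simp only [Finsupp.smul_apply, smul_eq_mul] at ha1
          rcases Nat.lt_or_ge (P 1) (2 * a 1) with hlt | hge
          · nlinarith
          · have ha1eq : (2 • a) 1 = epsL N := by simp only [Finsupp.smul_apply, smul_eq_mul]; omega
            have ha0 := zetaL_le hmem ha1eq
            simp only [Finsupp.smul_apply, smul_eq_mul] at ha0
            have hne2 : 2 • a ≠ P := fun h => ha (hA1pt a h.symm)
            have hne0 : 2 * a 0 ≠ P 0 := by
              intro h
              apply hne2
              exact Literature.RingTheory.TwoVariableSeries.finsupp_fin2_ext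
                (by simp only [Finsupp.smul_apply, smul_eq_mul]; omega) (by simp only [Finsupp.smul_apply, smul_eq_mul]; omega)
            have h2a1 : 2 * a 1 = P 1 := by omega
            have hP0le : P 0 ≤ 2 * a 0 := by rw [hP0]; exact ha0
            have hexp : 2 * (a 0 + L * a 1) = 2 * a 0 + L * (2 * a 1) := by ring
            rw [hexp, h2a1]
            omega)
      refine ⟨d, Or.inl hd, ?_⟩
      rw [hweight, hweight] at hdle
      rcases Nat.lt_or_ge (d 1) (P 1) with hlt | hge
      · exact Or.inl hlt
      · right
        have : d 1 = P 1 := by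
          by_contra hne
          have hgt : P 1 < d 1 := by omega
          nlinarith
        refine ⟨this, ?_⟩
        rw [this] at hdle
        omega
  obtain ⟨Q, hQN', hQle⟩ := hQ
  have hεQ := epsL_le hQN'
  rcases hQle with hlt | ⟨h1, h0⟩
  · left; rw [← hP1]; omega
  · rcases Nat.lt_or_ge (epsL N') (epsL N) with hlt' | hge'
    · exact Or.inl hlt'
    · right
      have hεeq : epsL N' = epsL N := by rw [← hP1, ← h1]; omega
      refine ⟨hεeq, ?_⟩
      rw [← hP0]
      exact le_trans (zetaL_le hQN' (by rw [hεeq, h1, hP1])) h0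

/-- UNIQUENESS OF `(2α, 2β)`: two well-prepared labels differing by a re-centring have the same `2α` and `2β`. -/
theorem alphaL_betaL_eq_of_wellPrepared {A₀ A₁ ψ : MvPowerSeries (Fin 2) k} (hWP : WellPrepared A₀ A₁)
    (hWP' : WellPrepared (A₀ + A₁ * ψ + ψ ^ 2) A₁) (hne : (newtonSet A₀ A₁).Nonempty)
    (hne' : (newtonSet (A₀ + A₁ * ψ + ψ ^ 2) A₁).Nonempty) :
    alphaL (newtonSet (A₀ + A₁ * ψ + ψ ^ 2) A₁) = alphaL (newtonSet A₀ A₁) ∧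
    betaL (newtonSet (A₀ + A₁ * ψ + ψ ^ 2) A₁) = betaL (newtonSet A₀ A₁) := by
  have h1 := lexLe_of_wellPrepared_recentre hWP hne ψ
  have h2 := lexLe_of_wellPrepared_recentre hWP' hne' ψ
  have hback : A₀ + A₁ * ψ + ψ ^ 2 + A₁ * ψ + ψ ^ 2 = A₀ := by
    have h2' : (2 : MvPowerSeries (Fin 2) k) = 0 := two_eq_zero
    linear_combination (A₁ * ψ + ψ ^ 2) * h2'
  rw [hback] at h2
  rcases h1 with h1 | ⟨h1a, h1b⟩ <;> rcases h2 with h2 | ⟨h2a, h2b⟩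
  · omega
  · omega
  · omega
  · exact ⟨h1a, le_antisymm h1b h2b⟩

/-- UNIQUENESS OF `(2ε, 2ζ)`: two well-prepared labels differing by a re-centring have the same `2ε` and `2ζ`. -/
theorem epsL_zetaL_eq_of_wellPrepared {A₀ A₁ ψ : MvPowerSeries (Fin 2) k} (hWP : WellPrepared A₀ A₁)
    (hWP' : WellPrepared (A₀ + A₁ * ψ + ψ ^ 2) A₁) (hne : (newtonSet A₀ A₁).Nonempty)
    (hne' : (newtonSet (A₀ + A₁ * ψ + ψ ^ 2) A₁).Nonempty) :
    epsL (newtonSet (A₀ + A₁ * ψ + ψ ^ 2) A₁) = epsL (newtonSet A₀ A₁) ∧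
    zetaL (newtonSet (A₀ + A₁ * ψ + ψ ^ 2) A₁) = zetaL (newtonSet A₀ A₁) := by
  have h1 := rowLe_of_wellPrepared_recentre hWP hne ψ
  have h2 := rowLe_of_wellPrepared_recentre hWP' hne' ψ
  have hback : A₀ + A₁ * ψ + ψ ^ 2 + A₁ * ψ + ψ ^ 2 = A₀ := by
    have h2' : (2 : MvPowerSeries (Fin 2) k) = 0 := two_eq_zero
    linear_combination (A₁ * ψ + ψ ^ 2) * h2'
  rw [hback] at h2
  rcases h1 with h1 | ⟨h1a, h1b⟩ <;> rcases h2 with h2 | ⟨h2a, h2b⟩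
  · omega
  · omega
  · omega
  · exact ⟨h1a, le_antisymm h1b h2b⟩

end MonicDescent

end Summit.ResolutionOfSingularities.ResolutionOfSingularities.Theorems

end
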